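import Summits.Ventures.CertifiedArithmetic.Expansions.CompressSharpStair
import Summits.Ventures.CertifiedArithmetic.Expansions.CompressCarryBound
import Mathlib.Algebra.Field.GeomSum
import Mathlib.Tactic.FieldSimp

/-!
# The sharp error of the largest component of COMPRESS(e) — Shewchuk's conjecture (new work)

New work of the certified-arithmetic venture (ENGINES group: shared numerical engines serving
client cells; rigour lives in the verifiers; every published number belongs to a client cell's
ledger, not to the engines group), built on the tree's formalisation of Shewchuk's COMPRESS
(`Literature/ComputerArithmetic/Shewchuk1997/Compress.lean`: `compress`, `compress_spec`).

THE QUESTION.  Theorem 23 of [Shewchuk1997, §2.7 p. 331] states that `h = COMPRESS(e)` is a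
nonoverlapping expansion with `Σ h = Σ e` whose largest component `hₙ` "approximates `h` with an
error smaller than `ulp(hₙ)`" (the tree: `CompressOut.approx`).  On p. 333 Shewchuk adds:
"Furthermore, the bound for `|h − hₙ|` is not tight. (I conjecture that the largest possible relative error
is exhibited by a number that contains a nonzero bit every `p`th bit; note that `1 + ½ulp(1) + ¼[ulp(1)]² + ⋯`
cannot be further compressed.) …"  For that number the error of the top component, in the unit of
Theorem 23, is `|h − hₙ| = ulp(hₙ)/2 · (1 + ε + ε² + ⋯)`, `ε = 2^(-p)`.

THE THEOREM (`compress_top_error`; precision `p ≥ 2`, gradual underflow, ANY round-to-nearest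
`fl` — any tie rule, even an input-dependent one — and every nonoverlapping expansion `e` of
floats, smallest component first, zeros allowed).  If `compress fl e` read from the top is
`L, t₁, …, t_k` then

  `|Σ e − L| = |t₁ + ⋯ + t_k| ≤ ulp(L)/2 · (1 + ε + ⋯ + ε^(k−1))`,   `ε = 2^(-p)`,

(`abs_sum_sub_compress_top_le`, closed form `abs_sum_sub_compress_top_le'`); hence, uniformly in `k`,
`|Σ e − L| < ulp(L)/2 · 2^p/(2^p − 1)` (`abs_sum_sub_compress_top_lt`).  The bound is the conjectured one
and it is ATTAINED for every `k` by Shewchuk's number (for `p = 4`, `k = 2`: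
`e = ⟨1, 16, 256⟩` is returned unchanged under ties-to-even and `|Σ e − 256| = 17 =
ulp(256)/2 · (1 + 1/16)`; the `example` at the end of the file), so in the unit of Theorem 23 the
conjecture is settled: the sharp constant is `½(1 + ε + ⋯ + ε^(k−1)) < ½ · 2^p/(2^p − 1)` in place
of `1`.  WHAT IS NOT CLAIMED: read literally as a bound on the relative error `|h − hₙ|/|h|`, the
extremality of that number is FALSE for input-dependent tie rules, which `IsRoundNearest` allows
(`p = 3`: `e = ⟨−1, 8, 0, 0, 64⟩` with the ties `fl 72 = 80` (upwards) and `fl (−9) = −8`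
(towards zero) gives `h = ⟨−1, −8, 80⟩`, `Σ h = 71`, and `|h − hₙ|/|h| = 9/71` exceeds both the
`9/73` of `⟨1, 8, 64⟩` and the supremum `2^(-p) = 1/8` over all of Shewchuk's numbers; found by the
adversarial model below).  It is FALSE for FIXED tie rules too: under IEEE roundTiesToAway (or
ties-to-odd) `e = ⟨−7, −112, −1024, 10240⟩` (`p = 3`, 14 binades — beyond the ranges checked below)
is a COMPRESS fixed point with `|h − hₙ|/|h| = 1143/9097 > 1/8` (`CompressRelativeErrorTiesAway.lean`);
for round-to-nearest-EVEN / ties-to-zero the relative reading is OPEN and not treated here.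

THE PROOF (new; the paper proves `< ulp`) is in three parts: the first traversal's stair is sharp
under powers of two (`CompressSharpStair.lean`); hence in every emitting step of the second
traversal the old carry lies strictly below the ulp of the new one (`CompressCarryBound.lean`);
so the components emitted so far — at most `ulp(Q)/2 · (1 + ε + ⋯)` inductively — are at most
`ε · ulp(Qₙ)/2 · (1 + ε + ⋯)` against the new carry `Qₙ` (or there are none: were
`ulp(Qₙ) < 2^(emin+p)`, then `ulp Q = 2^emin` and the emitted nonzero multiples of `2^emin` would
sum to less than `2^emin`, i.e. to zero, which they cannot), and the new roundoff adds `ulp(Qₙ)/2`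
(`compressUp_top_error` below).

EVIDENCE GATHERED BEFORE THE PROOF (integer model of the tree's `compress`; all inputs `e` with
`IsExpansion 1 e`, `p`-bit components below `2^(emin+E)`, signs free, zeros and subnormals allowed,
length `≤ n`).  Consistent ties (to even / away / to zero / to odd), `(p, E, n)` = `(2, 7, 6)`:
103 052 inputs per rule, `(3, 8, 6)`: 470 776, `(4, 9, 5)`: 539 343, `(4, 13, 4)` (to even):
1 958 304 — no violation, the finite-`k` bound attained (largest `|Σ t|/ulp(L)` = 21/32, 9/16,
17/32, 273/512).  Input-dependent ties (every tie resolved both ways), `(2, 7, 5)`: 25 058 runs,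
`(3, 8, 5)`: 96 773, `(4, 9, 5)`: 297 119, `(4, 13, 4)`: 1 376 661 — no violation of the ulp-form
bounds; the relative reading `|Σ t| ≤ (ε + ⋯ + ε^k)·|Σ h|` violated 194 / 215 / 164 / 238 times.

References: J. R. Shewchuk, Adaptive precision floating-point arithmetic and fast robust geometric
predicates, Discrete Comput. Geom. 18 (1997) 305–363, §2.7, Theorem 23 and p. 333 [Shewchuk1997];
ulp, roundings and FAST-TWO-SUM as in S. Boldo, C.-P. Jeannerod, G. Melquiond, J.-M. Muller,
Floating-point arithmetic, Acta Numerica / ACM Comput. Surv. 55 (2023), §2 [BoldoEtAl2023].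
-/

namespace Summit.Ventures.CertifiedArithmetic.Expansions

open Literature.ComputerArithmetic.JeannerodRump2018
open Literature.ComputerArithmetic.BoldoJeannerodMelquiondMuller2023 hiding twoSum twoSum_fst
open Literature.ComputerArithmetic.JoldesMullerPopescu2017 (ulp_le_of_abs_lt_two_zpow)
open Literature.ComputerArithmetic.GraillatMuller2025 (ulp_two_zpow)
open Literature.ComputerArithmetic.Shewchuk1997

variable {p : ℕ} {emin : ℤ} {fl : ℚ → ℚ}

/-! ### The geometric factor `1 + ε + ⋯ + ε^(k−1)`, `ε = 2^−p` -/

/-- `1 + ε + ⋯ + ε^k = 1 + ε·(1 + ⋯ + ε^(k−1))`. -/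
private theorem geom_succ (k : ℕ) :
    (Finset.range (k + 1)).sum (fun i => ((2 : ℚ) ^ p)⁻¹ ^ i) =
      1 + ((2 : ℚ) ^ p)⁻¹ * (Finset.range k).sum (fun i => ((2 : ℚ) ^ p)⁻¹ ^ i) := by
  rw [Finset.sum_range_succ', pow_zero, Finset.mul_sum, add_comm]
  congr 1
  refine Finset.sum_congr rfl (fun i _ => ?_)
  rw [pow_succ, mul_comm]

/-- The geometric factor is nonnegative. -/
private theorem geom_nonneg (k : ℕ) :
    0 ≤ (Finset.range k).sum (fun i => ((2 : ℚ) ^ p)⁻¹ ^ i) :=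
  Finset.sum_nonneg (fun i _ => pow_nonneg (inv_nonneg.mpr (by positivity)) i)

/-- The geometric factor is below its limit `1/(1 − ε) = 2^p/(2^p − 1)`. -/
private theorem geom_lt (hp : 1 ≤ p) (k : ℕ) :
    (Finset.range k).sum (fun i => ((2 : ℚ) ^ p)⁻¹ ^ i) < 2 ^ p / (2 ^ p - 1) := by
  have hT : (1 : ℚ) < 2 ^ p := one_lt_pow₀ (by norm_num) (by omega)
  have hT1 : (0 : ℚ) < 2 ^ p - 1 := by linarith
  induction k with
  | zero => rw [Finset.sum_range_zero]; exact div_pos (by positivity) hT1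
  | succ k ih =>
    rw [geom_succ]
    have hstep : ((2 : ℚ) ^ p)⁻¹ * (Finset.range k).sum (fun i => ((2 : ℚ) ^ p)⁻¹ ^ i) <
        ((2 : ℚ) ^ p)⁻¹ * (2 ^ p / (2 ^ p - 1)) :=
      mul_lt_mul_of_pos_left ih (inv_pos.mpr (by positivity))
    have hid : 1 + ((2 : ℚ) ^ p)⁻¹ * (2 ^ p / (2 ^ p - 1)) = 2 ^ p / (2 ^ p - 1) := by
      field_simp; ring
    linarith

/-- Closed form `(1 − ε^k)/(1 − ε)`. -/
private theorem geom_closed (hp : 1 ≤ p) (k : ℕ) :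
    (Finset.range k).sum (fun i => ((2 : ℚ) ^ p)⁻¹ ^ i) =
      (1 - (((2 : ℚ) ^ p)⁻¹) ^ k) / (1 - ((2 : ℚ) ^ p)⁻¹) := by
  have hT : (1 : ℚ) < 2 ^ p := one_lt_pow₀ (by norm_num) (by omega)
  have hne : ((2 : ℚ) ^ p)⁻¹ ≠ 1 := (inv_lt_one_of_one_lt₀ hT).ne
  rw [geom_sum_eq hne, show (1 : ℚ) - (((2 : ℚ) ^ p)⁻¹) ^ k = -((((2 : ℚ) ^ p)⁻¹) ^ k - 1) by ring,
    show (1 : ℚ) - ((2 : ℚ) ^ p)⁻¹ = -(((2 : ℚ) ^ p)⁻¹ - 1) by ring, neg_div_neg_eq]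

/-! ### The second traversal with the sharp invariant -/

/-- THE SECOND TRAVERSAL with the sharp invariant.  State as in `compressUp_spec`, plus: the stair
of the remaining first-traversal components `gs` is SHARP under powers of two (threaded from
`compressDown_sharp`), and the components `rs` emitted so far satisfy
`|Σ rs| ≤ ulp(Q)/2 · (1 + ε + ⋯ + ε^(|rs|−1))`.  Conclusion: the same for the final list. -/
private theorem compressUp_top_error (hp : 2 ≤ p) (hfl : IsRoundNearest p emin fl) :
    ∀ (gs : List ℚ) (Q : ℚ) (rs : List ℚ), UpInv p emin 1 rs Q →
      |rs.sum| ≤ ulp p emin Q / 2 * (Finset.range rs.length).sum (fun i => ((2 : ℚ) ^ p)⁻¹ ^ i) →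
      (∀ g ∈ gs, IsFloat p emin g) → (∀ g ∈ gs, (2 : ℚ) ^ (emin + p) ≤ |g|) →
      UStair p emin (Q + rs.sum) gs →
      (∀ (pre post : List ℚ) (g : ℚ), gs = pre ++ g :: post →
        (∃ j : ℤ, emin + p ≤ j ∧ |g| = 2 ^ j) → g * (Q + rs.sum + pre.sum) < 0 →
        |Q + rs.sum + pre.sum| < ulp p emin g / 2) →
      gs.IsChain (fun a b => |a| ≤ ulp p emin b) →
      (∀ g ∈ gs.head?, |Q| ≤ ulp p emin g) →
      ∀ L t, (rs.reverse ++ compressUp fl Q gs).reverse = L :: t →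
        |t.sum| ≤ ulp p emin L / 2 *
          (Finset.range t.length).sum (fun i => ((2 : ℚ) ^ p)⁻¹ ^ i) := by
  have hp1 : 1 ≤ p := le_trans (by norm_num) hp
  have hflc : RoundoffBelow 1 fl := roundoffBelow_one hp1 hfl
  intro gs
  induction gs with
  | nil =>
    intro Q rs _ hI _ _ _ _ _ _ L t hL
    rw [compressUp_nil, List.reverse_append, List.reverse_singleton, List.reverse_reverse,
      List.singleton_append] at hL
    obtain ⟨hQL, hrs⟩ := List.cons_eq_cons.mp hL
    subst hQL; subst hrs; exact hI
  | cons g rest ih =>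
    intro Q rs inv hI hF hbig hst hsh hch hQg L t hL
    have hg : IsFloat p emin g := hF g (by simp)
    have hgbig : (2 : ℚ) ^ (emin + p) ≤ |g| := hbig g (by simp)
    have hQg' : |Q| ≤ ulp p emin g := hQg g (by simp)
    have hF' : ∀ x ∈ rest, IsFloat p emin x := fun x hx => hF x (List.mem_cons_of_mem _ hx)
    have hbig' : ∀ x ∈ rest, (2 : ℚ) ^ (emin + p) ≤ |x| :=
      fun x hx => hbig x (List.mem_cons_of_mem _ hx)
    obtain ⟨hstg, hst'⟩ := uStair_cons.mp hst
    obtain ⟨hgU, hch'⟩ := List.isChain_cons.mp hch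
    have hg0 : g ≠ 0 := by
      intro h; rw [h, abs_zero] at hgbig
      exact absurd hgbig (not_le.mpr (zpow_pos (by norm_num) _))
    have hulpg : ulp p emin g ≤ |g| := ulp_le_abs_of_isFloat hg hg0
    have hQleg : |Q| ≤ |g| := hQg'.trans hulpg
    obtain ⟨h1, -, h2, h4⟩ := fastTwoSum_exact hp1 hfl hg inv.hQ hQleg
    -- the sharp stair under `g` itself
    have hsh_g : (∃ j : ℤ, emin + p ≤ j ∧ |g| = 2 ^ j) → g * (Q + rs.sum) < 0 →
        |Q + rs.sum| < ulp p emin g / 2 := by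
      intro hpow hsgn
      have := hsh [] rest g rfl hpow (by simpa using hsgn)
      simpa using this
    -- … and under the later components, re-addressed for the next state `(Qn, rs')`
    have hthread : ∀ (Qn : ℚ) (rs' : List ℚ), Qn + rs'.sum = Q + rs.sum + g →
        ∀ (pre post : List ℚ) (g' : ℚ), rest = pre ++ g' :: post →
          (∃ j : ℤ, emin + p ≤ j ∧ |g'| = 2 ^ j) → g' * (Qn + rs'.sum + pre.sum) < 0 →
          |Qn + rs'.sum + pre.sum| < ulp p emin g' / 2 := by
      intro Qn rs' hS pre post g' hsplit hpow hsgn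
      have heq : Q + rs.sum + (g :: pre).sum = Qn + rs'.sum + pre.sum := by
        rw [List.sum_cons, hS]; ring
      have := hsh (g :: pre) post g' (by rw [hsplit]; rfl) hpow (by rw [heq]; exact hsgn)
      rwa [heq] at this
    by_cases hq : (fastTwoSum fl g Q).2 = 0
    · -- exact step: the carry becomes `g + Q`, nothing is emitted
      obtain ⟨inv', hQnval, hQn_ge⟩ := inv.absorb hp hfl hg hgbig hQg' hq
      rw [compressUp_cons_of_eq_zero hq] at hL
      generalize hQn : (fastTwoSum fl g Q).1 = Qn at *
      have hS : Qn + rs.sum = Q + rs.sum + g := by rw [hQnval]; ring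
      have hQg_next : ∀ y ∈ rest.head?, |Qn| ≤ ulp p emin y := by
        intro y hy
        have hgy : |g| ≤ ulp p emin y := hgU y hy
        have hT : |Qn + rs.sum| < ulp p emin y := by rw [hS]; exact hst'.head_lt hy
        obtain ⟨u, -, hU⟩ := exists_ulp_eq_two_zpow (p := p) (emin := emin) y
        obtain ⟨k, -, hK⟩ := exists_ulp_eq_two_zpow (p := p) (emin := emin) Q
        have hkQ : OnGrid k Q := by
          obtain ⟨K, hK'⟩ := exists_eq_int_mul_ulp_of_isFloat (p := p) (emin := emin) inv.hQ
          exact ⟨K, by rw [← hK]; exact hK'⟩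
        have hkg : OnGrid k g := onGrid_of_two_zpow_le_ulp hg (by rw [← hK]; exact ulp_mono hQleg)
        have hkQn : OnGrid k Qn := by rw [hQnval]; exact hkg.add hkQ
        have hku : k ≤ u := by
          have : (2 : ℚ) ^ k ≤ (2 : ℚ) ^ u := by
            rw [← hK, ← hU]; exact (ulp_mono hQleg).trans (hulpg.trans hgy)
          exact (zpow_le_zpow_iff_right₀ (by norm_num : (1 : ℚ) < 2)).mp this
        have hr : |rs.sum| < (2 : ℚ) ^ k := by rw [← hK]; exact inv.sum_lt
        rw [hU]
        exact abs_le_two_zpow_of_onGrid hku hkQn hr (by rw [← hU]; exact hT)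
      have hI' : |rs.sum| ≤ ulp p emin Qn / 2 *
          (Finset.range rs.length).sum (fun i => ((2 : ℚ) ^ p)⁻¹ ^ i) :=
        hI.trans (mul_le_mul_of_nonneg_right
          (by linarith [ulp_mono (p := p) (emin := emin) hQn_ge]) (geom_nonneg _))
      exact ih Qn rs inv' hI' hF' hbig' (by rw [hS]; exact hst') (hthread Qn rs hS) hch' hQg_next
        L t hL
    · -- emitting step: `q ≠ 0` is pushed on top of `rs`, the carry becomes `Qn = fl (g + Q)`
      obtain ⟨inv', hbound⟩ := inv.emit hp hfl le_rfl hflc hg hgbig hQg' hq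
      rw [compressUp_cons_of_ne_zero hq] at hL
      generalize hQn : (fastTwoSum fl g Q).1 = Qn at *
      generalize hqn : (fastTwoSum fl g Q).2 = q at *
      have hS : Qn + (q :: rs).sum = Q + rs.sum + g := by rw [List.sum_cons]; linarith [h4]
      have hQg_next : ∀ y ∈ rest.head?, |Qn| ≤ ulp p emin y := by
        intro y hy
        have hgy : |g| ≤ ulp p emin y := hgU y hy
        have hT : |Qn + (q :: rs).sum| < ulp p emin y := by rw [hS]; exact hst'.head_lt hy
        obtain ⟨u, hu, hU⟩ := exists_ulp_eq_two_zpow (p := p) (emin := emin) y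
        obtain ⟨k, -, hK⟩ := exists_ulp_eq_two_zpow (p := p) (emin := emin) (g + Q)
        have hkQn : OnGrid k Qn := by
          obtain ⟨K, hK'⟩ := exists_fl_eq_int_mul_ulp hp1 hfl (g + Q)
          exact ⟨K, by rw [h1, hK', hK]⟩
        have hku : k ≤ u := by
          have ht2 : |g + Q| ≤ 2 * (2 : ℚ) ^ u :=
            calc |g + Q| ≤ |g| + |Q| := abs_add_le _ _
              _ ≤ |g| + |g| := by linarith
              _ ≤ 2 * (2 : ℚ) ^ u := by rw [← hU]; linarith
          have := ulp_le_two_zpow_of_abs_le hp hu ht2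
          rw [hK] at this
          exact (zpow_le_zpow_iff_right₀ (by norm_num : (1 : ℚ) < 2)).mp this
        have hr : |(q :: rs).sum| < (2 : ℚ) ^ k := by rw [← hK, List.sum_cons]; exact hbound
        rw [hU]
        exact abs_le_two_zpow_of_onGrid hku hkQn hr (by rw [← hU]; exact hT)
      -- THE HEART: the old carry lies below the ulp of the new one …
      have hcarry : |Q| < ulp p emin Qn := by
        rw [h1]
        exact compressUp_carry_lt_ulp hp hfl inv hg hgbig hQg' (by rw [← h2]; exact hq) hsh_g
      -- … so what was emitted before shrinks by the factor `ε = 2^-p` relative to the new carry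
      have hrs : |rs.sum| ≤ ((2 : ℚ) ^ p)⁻¹ * ulp p emin Qn / 2 *
          (Finset.range rs.length).sum (fun i => ((2 : ℚ) ^ p)⁻¹ ^ i) := by
        cases rs with
        | nil => simp
        | cons r tail =>
          obtain ⟨u, hu, hU⟩ := exists_ulp_eq_two_zpow (p := p) (emin := emin) Qn
          have hup : emin ≤ u - p := by
            by_contra hlt
            rw [not_le] at hlt
            have hQsmall : |Q| < (2 : ℚ) ^ (emin + p - 1) := by
              rw [hU] at hcarry
              exact hcarry.trans_le (zpow_le_zpow_right₀ (by norm_num) (by omega))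
            have hsum_lt : |(r :: tail).sum| < (2 : ℚ) ^ emin := by
              have := inv.sum_lt; rwa [ulp_eq_of_abs_lt hQsmall] at this
            have hgrid : OnGrid emin (r :: tail).sum :=
              OnGrid.listSum (fun x hx => OnGrid.of_isFloat (inv.floats x hx))
            have hsum0 : (r :: tail).sum = 0 := by
              by_contra h; exact absurd (hgrid.two_zpow_le_abs h) (not_le.mpr hsum_lt)
            have htail : |tail.sum| < |r| := abs_sum_tail_lt_head inv.floats inv.pw inv.ne
            rw [List.sum_cons] at hsum0
            have : |r| = |tail.sum| := by rw [show r = -tail.sum by linarith, abs_neg]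
            linarith
          have hulpQ : ulp p emin Q ≤ (2 : ℚ) ^ (u - p) :=
            ulp_le_of_abs_lt_two_zpow (by rw [← hU]; exact hcarry) hup
          have hfac : (2 : ℚ) ^ (u - (p : ℤ)) = ((2 : ℚ) ^ p)⁻¹ * ulp p emin Qn := by
            rw [hU, zpow_sub₀ (by norm_num : (2 : ℚ) ≠ 0), zpow_natCast, div_eq_inv_mul]
          rw [hfac] at hulpQ
          exact hI.trans (mul_le_mul_of_nonneg_right (by linarith) (geom_nonneg _))
      have hq_half : |q| ≤ ulp p emin Qn / 2 := by
        rw [h2, h1]; exact abs_sub_fl_le_half_ulp_fl hp1 hfl (g + Q)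
      have hI' : |(q :: rs).sum| ≤ ulp p emin Qn / 2 *
          (Finset.range (q :: rs).length).sum (fun i => ((2 : ℚ) ^ p)⁻¹ ^ i) := by
        rw [List.length_cons, geom_succ, List.sum_cons]
        calc |q + rs.sum| ≤ |q| + |rs.sum| := abs_add_le _ _
          _ ≤ ulp p emin Qn / 2 + ((2 : ℚ) ^ p)⁻¹ * ulp p emin Qn / 2 *
              (Finset.range rs.length).sum (fun i => ((2 : ℚ) ^ p)⁻¹ ^ i) :=
            add_le_add hq_half hrs
          _ = _ := by ring
      have hlist : rs.reverse ++ q :: compressUp fl Qn rest =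
          (q :: rs).reverse ++ compressUp fl Qn rest := by simp
      rw [hlist] at hL
      exact ih Qn (q :: rs) inv' hI' hF' hbig' (by rw [hS]; exact hst') (hthread Qn (q :: rs) hS) hch'
        hQg_next L t hL

/-! ### The theorems -/

/-- **HOW WELL THE LARGEST COMPONENT OF COMPRESS(e) APPROXIMATES THE SUM** (`p ≥ 2`, ANY
round-to-nearest, every nonoverlapping expansion `e` of floats).  If `compress fl e` read from the
top is `L, t…` (`t` = the `k` lower components, largest first), then
`|Σ t| ≤ ulp(L)/2 · (1 + ε + ε² + ⋯ + ε^(k-1))`, `ε = 2^(-p)` — and `Σ t = Σ e − L`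
(`abs_sum_sub_compress_top_le`).  The bound is attained for every `k` (see the examples at the
end of the file), and it is `< ulp(L)/2 · 2^p/(2^p − 1)` uniformly in `k`
(`abs_sum_sub_compress_top_lt`). -/
theorem compress_top_error (hp : 2 ≤ p) (hfl : IsRoundNearest p emin fl) {e : List ℚ}
    (he : ∀ x ∈ e, IsFloat p emin x) (hexp : IsExpansion 1 e) :
    ∀ L t, (compress fl e).reverse = L :: t →
      |t.sum| ≤ ulp p emin L / 2 * (Finset.range t.length).sum (fun i => ((2 : ℚ) ^ p)⁻¹ ^ i) := by
  cases hrev : e.reverse with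
  | nil =>
    have he0 : e = [] := by simpa using congrArg List.reverse hrev
    subst he0; simp [compress]
  | cons em rest =>
    have he' : e = rest.reverse ++ [em] := by simpa using congrArg List.reverse hrev
    have hcomp : compress fl e =
        compressUp fl (compressDown fl em rest).2 (compressDown fl em rest).1.reverse := by
      simp only [compress, hrev]
    rw [hcomp]
    subst he'
    have hem : IsFloat p emin em := he em (by simp)
    have hrestF : ∀ y ∈ rest, IsFloat p emin y := fun y hy => he y (by simp [hy])
    have hexp' : IsExpansion 1 rest.reverse := hexp.sublist (List.sublist_append_left _ _)
    have hbel : ∀ y ∈ rest, Below 1 y em := fun y hy =>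
      (List.pairwise_append.mp hexp).2.2 y (List.mem_reverse.mpr hy) em (by simp)
    have outd := compressDown_spec hp hfl rest em hem hrestF hexp' hbel
    have hsharpD := compressDown_sharp_stair hp hfl rest em hem hrestF hexp' hbel
    generalize (compressDown fl em rest).1 = gs at *
    generalize (compressDown fl em rest).2 = gb at *
    have inv : UpInv p emin 1 [] gb :=
      ⟨by simp, outd.hgb, List.Pairwise.nil, by simp, by simp, by simpa using ulp_pos _⟩
    have hst : UStair p emin (gb + ([] : List ℚ).sum) gs.reverse := by
      have h := uStair_reverse_of_dStair outd.stair
      rw [List.reverse_append, List.reverse_singleton, List.singleton_append, uStair_cons,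
        zero_add] at h
      simpa using h.2
    have hch0 := List.isChain_reverse.mpr outd.chain
    rw [List.reverse_append, List.reverse_singleton, List.singleton_append,
      List.isChain_cons] at hch0
    -- the sharp stair, re-addressed from the bottom as the second traversal sees it
    have hsharpU : ∀ (pre post : List ℚ) (g : ℚ), gs.reverse = pre ++ g :: post →
        (∃ j : ℤ, emin + p ≤ j ∧ |g| = 2 ^ j) → g * (gb + ([] : List ℚ).sum + pre.sum) < 0 →
        |gb + ([] : List ℚ).sum + pre.sum| < ulp p emin g / 2 := by
      intro pre post g hsplit hpow hsgn
      have hgs : gs = post.reverse ++ g :: pre.reverse := by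
        simpa using congrArg List.reverse hsplit
      have hsum : (pre.reverse ++ [gb]).sum = gb + ([] : List ℚ).sum + pre.sum := by
        simp [List.sum_reverse, add_comm]
      have h := hsharpD post.reverse (pre.reverse ++ [gb]) g (by rw [hgs]; simp) hpow
        (by rw [hsum]; exact hsgn)
      rwa [hsum] at h
    intro L t hL
    exact compressUp_top_error hp hfl gs.reverse gb [] inv (by simp)
      (fun g hg => outd.floats g (List.mem_reverse.mp hg))
      (fun g hg => outd.big g (List.mem_reverse.mp hg)) hst hsharpU hch0.2 hch0.1 L t
      (by simpa using hL)

/-- The same with the error written as `Σ e − L` (`Σ (compress fl e) = Σ e`, Theorem 23). -/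
theorem abs_sum_sub_compress_top_le (hp : 2 ≤ p) (hfl : IsRoundNearest p emin fl) {e : List ℚ}
    (he : ∀ x ∈ e, IsFloat p emin x) (hexp : IsExpansion 1 e) :
    ∀ L t, (compress fl e).reverse = L :: t →
      |e.sum - L| ≤ ulp p emin L / 2 * (Finset.range t.length).sum (fun i => ((2 : ℚ) ^ p)⁻¹ ^ i) := by
  intro L t hL
  have hsum : e.sum = L + t.sum := by
    rw [← compress_sum hp hfl he hexp, ← List.sum_reverse, hL, List.sum_cons]
  rw [hsum, add_sub_cancel_left]
  exact compress_top_error hp hfl he hexp L t hL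

/-- The same in closed form: `|Σ e − L| ≤ ulp(L)/2 · (1 − ε^k)/(1 − ε)`, `ε = 2^(-p)`, `k` the
number of lower components. -/
theorem abs_sum_sub_compress_top_le' (hp : 2 ≤ p) (hfl : IsRoundNearest p emin fl) {e : List ℚ}
    (he : ∀ x ∈ e, IsFloat p emin x) (hexp : IsExpansion 1 e) :
    ∀ L t, (compress fl e).reverse = L :: t →
      |e.sum - L| ≤ ulp p emin L / 2 *
        ((1 - (((2 : ℚ) ^ p)⁻¹) ^ t.length) / (1 - ((2 : ℚ) ^ p)⁻¹)) := by
  intro L t hL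
  rw [← geom_closed (le_trans (by norm_num) hp)]
  exact abs_sum_sub_compress_top_le hp hfl he hexp L t hL

/-- **UNIFORMLY IN THE LENGTH**: the largest component of `compress fl e` is within
`ulp(L)/2 · 2^p/(2^p − 1) = ulp(L) · 2^(p-1)/(2^p − 1)` of `Σ e`, strictly — barely more than the
half ulp of a correctly rounded sum, and never reached. -/
theorem abs_sum_sub_compress_top_lt (hp : 2 ≤ p) (hfl : IsRoundNearest p emin fl) {e : List ℚ}
    (he : ∀ x ∈ e, IsFloat p emin x) (hexp : IsExpansion 1 e) :
    ∀ L t, (compress fl e).reverse = L :: t →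
      |e.sum - L| < ulp p emin L / 2 * (2 ^ p / (2 ^ p - 1)) := by
  intro L t hL
  exact (abs_sum_sub_compress_top_le hp hfl he hexp L t hL).trans_lt
    (mul_lt_mul_of_pos_left (geom_lt (le_trans (by norm_num) hp) _)
      (by linarith [ulp_pos (p := p) (emin := emin) L]))


/-! ### Sharpness: Shewchuk's number is returned unchanged and attains the bound -/

/-- SHARPNESS (`p = 4`, `k = 2`; an evaluation in the style of the tree's sanity check of
`compress`): with the five roundings that occur — `272 ↦ 256` and `17 ↦ 16` are the ties, resolved
to even; `0, 1, 16` are floats — COMPRESS returns Shewchuk's number `⟨1, 16, 256⟩` (a nonzero bit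
every 4th bit) unchanged, and its top component misses the sum by exactly the bound of
`compress_top_error`: `|Σ e − 256| = 17 = ulp(256)/2 · (1 + 2⁻⁴)` (here `emin = −20`). -/
example {fl : ℚ → ℚ} (h0 : fl 0 = 0) (h1 : fl 1 = 1) (h16 : fl 16 = 16) (h17 : fl 17 = 16)
    (h272 : fl 272 = 256) :
    compress fl [1, 16, 256] = [1, 16, 256] ∧
      |([1, 16, 256] : List ℚ).sum - 256| =
        ulp 4 (-20) 256 / 2 * (Finset.range 2).sum (fun i => ((2 : ℚ) ^ (4 : ℕ))⁻¹ ^ i) := by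
  refine ⟨by norm_num [compress, compressDown, compressUp, fastTwoSum, h0, h1, h16, h17, h272], ?_⟩
  rw [show (256 : ℚ) = (2 : ℚ) ^ (8 : ℤ) by norm_num,
    ulp_two_zpow (p := 4) (emin := -20) (E := 8) (by norm_num)]
  norm_num [Finset.sum_range_succ]

end Summit.Ventures.CertifiedArithmetic.Expansions
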